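import Summits.QuantumFields.BalabanUV.Beta.GAN24.ChargeTowerLegs

/-!
# `BalabanUV.Beta.GAN24.VertexSlotZeroMode` — binder row G-an2-4 ∕ (CONV-C), row (C) at the levels `j ≥ 1`, CONTACT side; Part 27 of
# `GAN24/FourFaceGaugeSectors`: **THE SLOT ZERO-MODE RULE** — summing the coarse bond slot `(κ′, u′)` of the wall's chain-rule vertices over the whole step lattice replaces
# `dM G_j Lc S M κ′ u′` by `cH_j ×` the stencil family summed over the EXIT FACE in its own direction, and kills the multiplier vertex:
# `Σ'_{u′} (vertexOfK G_j Lc S κ′ u′) w′ w g b = cH_j·Σ'_t 𝟙[t_{κ′} % Lc = Lc−1]·S κ′ t w′ w g b`, `Σ'_{u′} (vertexOfM G_j Lc M κ′ u′) w′ w g b = 0`,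
# hence `Σ'_{u′} (dM G_j Lc S M κ′ u′) w′ w g b = cH_j·Σ'_t 𝟙[t_{κ′} % Lc = Lc−1]·S κ′ t w′ w g b` — every `j`, in-block root, any local stencil family `S`, any vertex family `M`

NOT IN PRINT; OUR BOOKKEEPING (G-an2-4 crux team (2), leaf prover `b2b-balaban-gan24-formalise-leaf-02`, gen 66).  WHY.  Part 26 writes road-P2's zero mode
`zmode Lc (T2RecAt … (j+1))` as `Σ_{r∈cell} Σ'_{u′}` of the interior `Y_j(κr; κ′u′)` on the exit faces; the second slot `u′` runs over the whole step lattice, and inside every word of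
`Y_j` it is the bond index of a chain-rule vertex `dM G_j Lc S_j M_j κ′ u′ = vertexOfK … + vertexOfM …` (or of the columns feeding `WrecAt j`).  road-P2 g41's column charges at the
constant weight `f ≡ 1` (`ChargeTowerLegs.hasSum_col_coord_inl ∕ _inr`) say what the slot total of ONE column is: `Σ_{u′} colH G_j Lc κ′ u′ l t = cH_j·𝟙[l = κ′ ∧ t_{κ′} % Lc = Lc−1]`
and `Σ_{u′} colM G_j Lc κ′ u′ ρ w″ = 0`.  THIS FILE carries that through the superpositions (Fubini over (slot, table index): absolute summability from the column decay
`e^{−δ|t − Lc•u′|}` and the tables' localisation at `t` resp. `Lc•w″`) — the rule the successor applies word by word (memo `HOME/…/leaf-02/g66/CT-VALUES-PLAN-v0.md` §7).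

WHAT (every `j`, in-block root `ρ = toSite r`, `G_j = coDressKBmAt ρ Lc (KInvStep Lc j)`, `cH_j = (stepScale_j·Lc^{d+1})⁻¹`; [folklore] Fubini BY NAME over road-P2's column charges;
0 `def`, 0 cited facts, 0 `def … : Prop`, 0 sorry):
* §1 `hasSum_slot_colH`, `hasSum_slot_colM` (the column totals over the slot, `f ≡ 1`); `summable_slot_table` (the (table-index, slot) product family is absolutely summable).
* §2 **`hasSum_slot_vertexOfK`** (per direction), **`hasSum_slot_vertexOfK'`** (folded); §3 `summable_slot_table'` (coarse table index), **`hasSum_slot_vertexOfM`** (`= 0`),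
  **`hasSum_slot_dM`** (the displayed rule, entrywise `HasSum` over `u′`).
HONEST FRAMING (cell contract, verbatim): «discharging `BetaPertH` makes Bałaban's UV stability UNCONDITIONAL — a real constructive-QFT result; it is NOT the continuum limit and
NOT the Clay problem.»  HONEST DEPENDENCY (verbatim): «continuum YM on T⁴ ⇐ BetaPertH ∧ nine spine estimates (0/9 proved); BetaPertH ⇐ (D1) ∧ (D4) ∧ CAP+tail; G-an2-4
gates asym, D1 and NE2/3/4.»  Asserts NO value of any resolvent column beyond road-P2's two column charges (d1-leaf-07's ∕ an1's column laws); NOTHING of (C) at j ≥ 1 ∕ (C)sym ∕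
(Q-L) ∕ (FL) ∕ «T2Shape» ∕ «T2Drift» ∕ (hW, hWall) discharged; NEVER «G-an2-4 closed» as (CONV-C); NOT D1, NOT `BetaPertH`, NOT continuum, NOT Clay.  2026-08-23; no existing file touched.
-/

noncomputable section

open Finset
open scoped BigOperators
open Literature.MathematicalPhysics.QuantumFieldTheory
open Literature.MathematicalPhysics.QuantumFieldTheory.Balaban1983to89
open Literature.MathematicalPhysics.QuantumFieldTheory.Balaban1983to89.Beta
open B12Sec2to5 (l1 l1_nonneg)
open ExpKernelCalculus (Site MKer BiLoc Decays VertexFamily Zl summable_exp_shift l1_sub_symm l1_natSmul tsum_exp_shift)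
open OneStepResolventKernel (Fib LocStencil wsum)
open AffineAveraging (box toSite)
open AveragingContours (blk)
open OneStepKernelFamily (KInvStep colH vertexOfK abs_colH_le)
open SecondOrderResponse (colM vertexOfM dM abs_colM_le)
open InterLevelTransport (cwsum cwsum_apply)
open Summit.QuantumFields.BalabanUV.Beta.TameKernelCalculus
open Summit.QuantumFields.BalabanUV.Beta.AxialDressingRooted (coDressKBmAt decays_coDressKBmAt_KInvStep)
open Summit.QuantumFields.BalabanUV.Beta.BorderedHessian (stepScale)
open Summit.QuantumFields.BalabanUV.Beta.GAN24.KernelLegCharges (summable_exp_coarse)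
open Summit.QuantumFields.BalabanUV.Beta.GAN24.ResolventLegCharges (tsum_exp_coarse_le summable_exp_coarse')
open Summit.QuantumFields.BalabanUV.Beta.GAN24.ChargeTowerLegs (hasSum_col_coord_inl hasSum_col_coord_inr)

namespace Summit.QuantumFields.BalabanUV.Beta.GAN24.VertexSlotZeroMode

variable {d : ℕ} {Lc : ℕ} [NeZero Lc] {r : Fin (d + 1) → ℕ}

/-! ## §1 The column totals over the slot; summability of the (slot, table-index) family -/

/-- [folklore] **THE `ℋ`-COLUMN TOTAL OVER THE SLOT** (road-P2's `hasSum_col_coord_inl` at `f ≡ 1`): `Σ_{u′} colH G_j Lc κ′ u′ l t = cH_j·𝟙[l = κ′ ∧ t_{κ′} % Lc = Lc−1]`. -/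
theorem hasSum_slot_colH (hr : r ∈ box (d + 1) Lc) (j : ℕ) (κ' l : Fin (d + 1)) (t : Site (d + 1)) :
    HasSum (fun u' : Site (d + 1) => colH (coDressKBmAt (toSite r) Lc (KInvStep (d := d) Lc j)) Lc κ' u' l t)
      ((stepScale d Lc j * (Lc : ℝ) ^ (d + 1))⁻¹ * (if l = κ' ∧ t κ' % (Lc : ℤ) = (Lc : ℤ) - 1 then 1 else 0)) := by
  have h := hasSum_col_coord_inl hr j κ' (fun _ => (1 : ℝ)) (B := 1) (fun _ => by rw [abs_one]) t l
  simp only [mul_one] at h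
  exact h

/-- [folklore] **THE MULTIPLIER-COLUMN TOTAL OVER THE SLOT VANISHES** (road-P2's `hasSum_col_coord_inr` at `f ≡ 1`): `Σ_{u′} colM G_j Lc κ′ u′ ρ w″ = 0`. -/
theorem hasSum_slot_colM (hr : r ∈ box (d + 1) Lc) (j : ℕ) (κ' ρ : Fin (d + 1)) (w'' : Site (d + 1)) :
    HasSum (fun u' : Site (d + 1) => colM (coDressKBmAt (toSite r) Lc (KInvStep (d := d) Lc j)) Lc κ' u' ρ w'') 0 := by
  have h := hasSum_col_coord_inr hr j κ' (fun _ => (1 : ℝ)) (B := 1) (fun _ => by rw [abs_one]) ((Lc : ℤ) • w'') ρ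
  simp only [mul_one] at h
  exact h

omit [NeZero Lc] in
/-- [folklore] **THE (TABLE-INDEX, SLOT) FAMILY IS ABSOLUTELY SUMMABLE**: for a column weight `c u′ t` with `|c u′ t| ≤ C·e^{−δ|t − Lc•u′|}` and a table value `T t` with
`|T t| ≤ C′·e^{−δ′|a₀ − t|}` (any anchor `a₀`), the family `(t, u′) ↦ c u′ t·T t` is summable on `Site × Site` (`1 ≤ Lc`; coarse sums uniformly bounded, `tsum_exp_coarse_le`). -/
theorem summable_slot_table (hLc : 1 ≤ Lc) {c : Site (d + 1) → Site (d + 1) → ℝ} {T : Site (d + 1) → ℝ} {C C' δ δ' : ℝ} (hδ : 0 < δ) (hδ' : 0 < δ')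
    (hc : ∀ u' t, |c u' t| ≤ C * Real.exp (-δ * l1 (t - (Lc : ℤ) • u'))) (a₀ : Site (d + 1)) (hT : ∀ t, |T t| ≤ C' * Real.exp (-δ' * l1 (a₀ - t))) :
    Summable fun tu : Site (d + 1) × Site (d + 1) => c tu.2 tu.1 * T tu.1 := by
  haveI : NeZero Lc := ⟨Nat.one_le_iff_ne_zero.1 hLc⟩
  have hC : 0 ≤ C := (mul_nonneg_iff_of_pos_right (Real.exp_pos _)).1 ((abs_nonneg _).trans (hc 0 0))
  have hC' : 0 ≤ C' := (mul_nonneg_iff_of_pos_right (Real.exp_pos _)).1 ((abs_nonneg _).trans (hT a₀))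
  -- majorant in the orientation of `summable_exp_coarse` ∕ `tsum_exp_coarse_le`
  have hM0 : ∀ tu : Site (d + 1) × Site (d + 1),
      0 ≤ (C' * Real.exp (-δ' * l1 (a₀ - tu.1))) * (C * Real.exp (-δ * l1 ((Lc : ℤ) • tu.2 - tu.1))) := fun tu => by positivity
  have hfib : ∀ t : Site (d + 1), Summable fun u' : Site (d + 1) =>
      (C' * Real.exp (-δ' * l1 (a₀ - t))) * (C * Real.exp (-δ * l1 ((Lc : ℤ) • u' - t))) := fun t =>
    ((summable_exp_coarse (d := d) hLc hδ t).mul_left C).mul_left _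
  have hfib_le : ∀ t : Site (d + 1), (∑' u' : Site (d + 1), (C' * Real.exp (-δ' * l1 (a₀ - t))) * (C * Real.exp (-δ * l1 ((Lc : ℤ) • u' - t))))
      ≤ (C' * Real.exp (-δ' * l1 (a₀ - t))) * (C * (Real.exp (δ * ((Lc : ℝ) * (d + 1))) * Zl (d + 1) δ)) := by
    intro t
    rw [tsum_mul_left, tsum_mul_left]
    exact mul_le_mul_of_nonneg_left (mul_le_mul_of_nonneg_left (tsum_exp_coarse_le (d := d) Lc hδ t) hC) (by positivity)
  have hMs : Summable fun tu : Site (d + 1) × Site (d + 1) =>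
      (C' * Real.exp (-δ' * l1 (a₀ - tu.1))) * (C * Real.exp (-δ * l1 ((Lc : ℤ) • tu.2 - tu.1))) := by
    refine (summable_prod_of_nonneg hM0).2 ⟨hfib, ?_⟩
    refine Summable.of_nonneg_of_le (fun t => tsum_nonneg fun u' => hM0 (t, u')) hfib_le ?_
    exact ((summable_exp_shift hδ' a₀).mul_left C').mul_right _
  refine Summable.of_norm_bounded hMs (fun tu => ?_)
  rw [Real.norm_eq_abs, abs_mul]
  have h1 := hc tu.2 tu.1
  have h2 := hT tu.1
  rw [l1_sub_symm] at h1
  calc |c tu.2 tu.1| * |T tu.1| ≤ (C * Real.exp (-δ * l1 ((Lc : ℤ) • tu.2 - tu.1))) * (C' * Real.exp (-δ' * l1 (a₀ - tu.1))) :=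
        mul_le_mul h1 h2 (abs_nonneg _) ((abs_nonneg _).trans h1)
    _ = _ := by ring


/-! ## §2 The slot zero modes of the chain-rule vertices -/

/-- NOT IN PRINT; OUR BOOKKEEPING.  **THE SLOT ZERO MODE OF THE FIELD-COLUMN VERTEX** (every `j`, in-block root, any local stencil family `S`, entrywise):
`Σ_{u′} (vertexOfK G_j Lc S κ′ u′) w′ w g b = Σ_l cH_j·Σ'_t 𝟙[l = κ′ ∧ t_{κ′} % Lc = Lc−1]·S l t w′ w g b` (= `cH_j·Σ'_t 𝟙[t_{κ′} % Lc = Lc−1]·S κ′ t w′ w g b`: only the stencils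
of the slot's OWN direction, on the EXIT FACE of the step blocks, survive) — Fubini over (table index, slot) by `summable_slot_table`, then `hasSum_slot_colH`. -/
theorem hasSum_slot_vertexOfK (hr : r ∈ box (d + 1) Lc) (j : ℕ) {S : Fin (d + 1) → Site (d + 1) → MKer (d + 1) (Fib d)} {Cs δs : ℝ}
    (hS : LocStencil S Cs δs) (hδs : 0 < δs) (κ' : Fin (d + 1)) (w' w : Site (d + 1)) (g b : Fib d) :
    HasSum (fun u' : Site (d + 1) => vertexOfK (coDressKBmAt (toSite r) Lc (KInvStep (d := d) Lc j)) Lc S κ' u' w' w g b)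
      (∑ l : Fin (d + 1), (stepScale d Lc j * (Lc : ℝ) ^ (d + 1))⁻¹ *
        ∑' t : Site (d + 1), (if l = κ' ∧ t κ' % (Lc : ℤ) = (Lc : ℤ) - 1 then S l t w' w g b else 0)) := by
  have hLc : 1 ≤ Lc := Nat.one_le_iff_ne_zero.2 (NeZero.ne Lc)
  obtain ⟨δG, CG, hδG, hCG, hG⟩ := decays_coDressKBmAt_KInvStep (d := d) hr j
  have hCs : 0 ≤ Cs := (hS 0 0).nonneg (Sum.inl 0)
  -- per table direction `l`: the family `(t, u′) ↦ colH … κ′ u′ l t · S l t w′ w g b`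
  have hl : ∀ l : Fin (d + 1), HasSum (fun u' : Site (d + 1) =>
      ∑' t : Site (d + 1), colH (coDressKBmAt (toSite r) Lc (KInvStep (d := d) Lc j)) Lc κ' u' l t * S l t w' w g b)
      ((stepScale d Lc j * (Lc : ℝ) ^ (d + 1))⁻¹ * ∑' t : Site (d + 1), (if l = κ' ∧ t κ' % (Lc : ℤ) = (Lc : ℤ) - 1 then S l t w' w g b else 0)) := by
    intro l
    have hFs : Summable (fun tu : Site (d + 1) × Site (d + 1) =>
        colH (coDressKBmAt (toSite r) Lc (KInvStep (d := d) Lc j)) Lc κ' tu.2 l tu.1 * S l tu.1 w' w g b) :=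
      summable_slot_table (d := d) hLc hδG hδs (c := fun u' t => colH (coDressKBmAt (toSite r) Lc (KInvStep (d := d) Lc j)) Lc κ' u' l t)
        (T := fun t => S l t w' w g b) (fun u' t => abs_colH_le hG κ' u' l t) w'
        (fun t => (hS l t w' w g b).trans (mul_le_mul_of_nonneg_left (Real.exp_le_exp.2 (by nlinarith [l1_nonneg (w - t), hδs.le])) hCs))
    -- swap to `(u′, t)` and sum the fibres
    have hGs := (Equiv.prodComm (Site (d + 1)) (Site (d + 1))).summable_iff.2 hFs
    have h1 := hGs.hasSum.prod_fiberwise fun u' => (hGs.prod_factor u').hasSum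
    have e1 : (∑' p : Site (d + 1) × Site (d + 1), ((fun tu : Site (d + 1) × Site (d + 1) =>
        colH (coDressKBmAt (toSite r) Lc (KInvStep (d := d) Lc j)) Lc κ' tu.2 l tu.1 * S l tu.1 w' w g b) ∘
          ⇑(Equiv.prodComm (Site (d + 1)) (Site (d + 1)))) p)
        = ∑' p : Site (d + 1) × Site (d + 1), colH (coDressKBmAt (toSite r) Lc (KInvStep (d := d) Lc j)) Lc κ' p.2 l p.1 * S l p.1 w' w g b :=
      (Equiv.prodComm (Site (d + 1)) (Site (d + 1))).tsum_eq
        (fun tu : Site (d + 1) × Site (d + 1) => colH (coDressKBmAt (toSite r) Lc (KInvStep (d := d) Lc j)) Lc κ' tu.2 l tu.1 * S l tu.1 w' w g b)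
    rw [e1, hFs.tsum_prod] at h1
    have e3 : ∀ t : Site (d + 1), (∑' u' : Site (d + 1), colH (coDressKBmAt (toSite r) Lc (KInvStep (d := d) Lc j)) Lc κ' u' l t * S l t w' w g b)
        = ((stepScale d Lc j * (Lc : ℝ) ^ (d + 1))⁻¹ * (if l = κ' ∧ t κ' % (Lc : ℤ) = (Lc : ℤ) - 1 then 1 else 0)) * S l t w' w g b := by
      intro t
      rw [tsum_mul_right, (hasSum_slot_colH hr j κ' l t).tsum_eq]
    have ev : (∑' t : Site (d + 1), ((stepScale d Lc j * (Lc : ℝ) ^ (d + 1))⁻¹ * (if l = κ' ∧ t κ' % (Lc : ℤ) = (Lc : ℤ) - 1 then 1 else 0)) * S l t w' w g b)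
        = (stepScale d Lc j * (Lc : ℝ) ^ (d + 1))⁻¹ * ∑' t : Site (d + 1), (if l = κ' ∧ t κ' % (Lc : ℤ) = (Lc : ℤ) - 1 then S l t w' w g b else 0) := by
      rw [← tsum_mul_left]
      exact tsum_congr fun t => by split_ifs <;> ring
    simp only [Function.comp, Equiv.prodComm_apply, Prod.swap, e3, ev] at h1
    exact h1
  -- sum the directions
  have h := hasSum_sum fun l (_ : l ∈ (Finset.univ : Finset (Fin (d + 1)))) => hl l
  refine h.congr_fun fun u' => ?_
  simp only [vertexOfK, wsum]

/-- NOT IN PRINT; OUR BOOKKEEPING.  The same with the direction sum folded: `Σ_{u′} (vertexOfK G_j Lc S κ′ u′) w′ w g b = cH_j·Σ'_t 𝟙[t_{κ′} % Lc = Lc−1]·S κ′ t w′ w g b`. -/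
theorem hasSum_slot_vertexOfK' (hr : r ∈ box (d + 1) Lc) (j : ℕ) {S : Fin (d + 1) → Site (d + 1) → MKer (d + 1) (Fib d)} {Cs δs : ℝ}
    (hS : LocStencil S Cs δs) (hδs : 0 < δs) (κ' : Fin (d + 1)) (w' w : Site (d + 1)) (g b : Fib d) :
    HasSum (fun u' : Site (d + 1) => vertexOfK (coDressKBmAt (toSite r) Lc (KInvStep (d := d) Lc j)) Lc S κ' u' w' w g b)
      ((stepScale d Lc j * (Lc : ℝ) ^ (d + 1))⁻¹ * ∑' t : Site (d + 1), (if t κ' % (Lc : ℤ) = (Lc : ℤ) - 1 then S κ' t w' w g b else 0)) := by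
  have h := hasSum_slot_vertexOfK hr j hS hδs κ' w' w g b
  rw [Finset.sum_eq_single κ' (fun l _ hl => ?_) (fun h => absurd (Finset.mem_univ κ') h)] at h
  · simp only [true_and] at h
    exact h
  · have e : (fun t : Site (d + 1) => (if l = κ' ∧ t κ' % (Lc : ℤ) = (Lc : ℤ) - 1 then S l t w' w g b else 0)) = fun _ => 0 :=
      funext fun t => if_neg (fun hh => hl hh.1)
    rw [e, tsum_zero, mul_zero]


/-! ## §3 The multiplier vertex has NO slot zero mode; the rule for `dM` -/

omit [NeZero Lc] in
/-- [folklore] **THE (COARSE TABLE-INDEX, SLOT) FAMILY IS ABSOLUTELY SUMMABLE**: for a multiplier-column weight `c u′ w″` with `|c u′ w″| ≤ C·e^{−δ|Lc•w″ − Lc•u′|}` and a table value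
`T w″` with `|T w″| ≤ C′·e^{−δ′|a₀ − Lc•w″|}`, the family `(w″, u′) ↦ c u′ w″·T w″` is summable (`1 ≤ Lc`; `|Lc•v|₁ = Lc·|v|₁ ≥ |v|₁`). -/
theorem summable_slot_table' (hLc : 1 ≤ Lc) {c : Site (d + 1) → Site (d + 1) → ℝ} {T : Site (d + 1) → ℝ} {C C' δ δ' : ℝ} (hδ : 0 < δ) (hδ' : 0 < δ')
    (hc : ∀ u' w'', |c u' w''| ≤ C * Real.exp (-δ * l1 ((Lc : ℤ) • w'' - (Lc : ℤ) • u'))) (a₀ : Site (d + 1))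
    (hT : ∀ w'', |T w''| ≤ C' * Real.exp (-δ' * l1 (a₀ - (Lc : ℤ) • w''))) :
    Summable fun wu : Site (d + 1) × Site (d + 1) => c wu.2 wu.1 * T wu.1 := by
  have hC : 0 ≤ C := (mul_nonneg_iff_of_pos_right (Real.exp_pos _)).1 ((abs_nonneg _).trans (hc 0 0))
  have hC' : 0 ≤ C' := (mul_nonneg_iff_of_pos_right (Real.exp_pos _)).1 ((abs_nonneg _).trans (hT 0))
  -- the coarse separation dominates the unscaled one
  have hdom : ∀ w'' u' : Site (d + 1), Real.exp (-δ * l1 ((Lc : ℤ) • w'' - (Lc : ℤ) • u')) ≤ Real.exp (-δ * l1 (w'' - u')) := by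
    intro w'' u'
    rw [← smul_sub, l1_natSmul, Real.exp_le_exp]
    have h0 := l1_nonneg (w'' - u')
    have h1 : (1 : ℝ) ≤ (Lc : ℝ) := by exact_mod_cast hLc
    nlinarith [mul_nonneg (mul_nonneg hδ.le h0) (sub_nonneg.2 h1)]
  have hM0 : ∀ wu : Site (d + 1) × Site (d + 1),
      0 ≤ (C' * Real.exp (-δ' * l1 (a₀ - (Lc : ℤ) • wu.1))) * (C * Real.exp (-δ * l1 (wu.1 - wu.2))) := fun wu => by positivity
  have hfib : ∀ w'' : Site (d + 1), Summable fun u' : Site (d + 1) =>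
      (C' * Real.exp (-δ' * l1 (a₀ - (Lc : ℤ) • w''))) * (C * Real.exp (-δ * l1 (w'' - u'))) := fun w'' =>
    ((summable_exp_shift hδ w'').mul_left C).mul_left _
  have hfib_eq : ∀ w'' : Site (d + 1), (∑' u' : Site (d + 1), (C' * Real.exp (-δ' * l1 (a₀ - (Lc : ℤ) • w''))) * (C * Real.exp (-δ * l1 (w'' - u'))))
      = (C' * Real.exp (-δ' * l1 (a₀ - (Lc : ℤ) • w''))) * (C * Zl (d + 1) δ) := by
    intro w''
    rw [tsum_mul_left, tsum_mul_left, tsum_exp_shift]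
  have hMs : Summable fun wu : Site (d + 1) × Site (d + 1) =>
      (C' * Real.exp (-δ' * l1 (a₀ - (Lc : ℤ) • wu.1))) * (C * Real.exp (-δ * l1 (wu.1 - wu.2))) := by
    refine (summable_prod_of_nonneg hM0).2 ⟨hfib, ?_⟩
    simp only [hfib_eq]
    exact ((summable_exp_coarse' (d := d) hLc hδ' a₀).mul_left C').mul_right _
  refine Summable.of_norm_bounded hMs (fun wu => ?_)
  rw [Real.norm_eq_abs, abs_mul]
  have h1 := (hc wu.2 wu.1).trans (mul_le_mul_of_nonneg_left (hdom wu.1 wu.2) hC)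
  have h2 := hT wu.1
  calc |c wu.2 wu.1| * |T wu.1| ≤ (C * Real.exp (-δ * l1 (wu.1 - wu.2))) * (C' * Real.exp (-δ' * l1 (a₀ - (Lc : ℤ) • wu.1))) :=
        mul_le_mul h1 h2 (abs_nonneg _) ((abs_nonneg _).trans h1)
    _ = _ := by ring

/-- NOT IN PRINT; OUR BOOKKEEPING.  **THE MULTIPLIER-COLUMN VERTEX HAS NO SLOT ZERO MODE** (every `j`, in-block root, any vertex family `M`, entrywise):
`Σ_{u′} (vertexOfM G_j Lc M κ′ u′) w′ w g b = 0` — road-P2's `hasSum_col_coord_inr` at `f ≡ 1` through the coarse superposition (Fubini by `summable_slot_table'`). -/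
theorem hasSum_slot_vertexOfM (hr : r ∈ box (d + 1) Lc) (j : ℕ) {M : Fin (d + 1) → Site (d + 1) → MKer (d + 1) (Fib d)} {CM δM : ℝ}
    (hM : VertexFamily M Lc CM δM) (hδM : 0 < δM) (κ' : Fin (d + 1)) (w' w : Site (d + 1)) (g b : Fib d) :
    HasSum (fun u' : Site (d + 1) => vertexOfM (coDressKBmAt (toSite r) Lc (KInvStep (d := d) Lc j)) Lc M κ' u' w' w g b) 0 := by
  have hLc : 1 ≤ Lc := Nat.one_le_iff_ne_zero.2 (NeZero.ne Lc)
  obtain ⟨δG, CG, hδG, hCG, hG⟩ := decays_coDressKBmAt_KInvStep (d := d) hr j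
  have hCM : 0 ≤ CM := (hM 0 0).nonneg (Sum.inl 0)
  have hρ : ∀ ρ : Fin (d + 1), HasSum (fun u' : Site (d + 1) =>
      ∑' w'' : Site (d + 1), colM (coDressKBmAt (toSite r) Lc (KInvStep (d := d) Lc j)) Lc κ' u' ρ w'' * M ρ w'' w' w g b) 0 := by
    intro ρ
    have hFs : Summable (fun wu : Site (d + 1) × Site (d + 1) =>
        colM (coDressKBmAt (toSite r) Lc (KInvStep (d := d) Lc j)) Lc κ' wu.2 ρ wu.1 * M ρ wu.1 w' w g b) :=
      summable_slot_table' (d := d) hLc hδG hδM (c := fun u' w'' => colM (coDressKBmAt (toSite r) Lc (KInvStep (d := d) Lc j)) Lc κ' u' ρ w'')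
        (T := fun w'' => M ρ w'' w' w g b) (fun u' w'' => abs_colM_le hG κ' u' ρ w'') w'
        (fun w'' => (hM ρ w'' w' w g b).trans (mul_le_mul_of_nonneg_left (Real.exp_le_exp.2 (by nlinarith [l1_nonneg (w - (Lc : ℤ) • w''), hδM.le])) hCM))
    have hGs := (Equiv.prodComm (Site (d + 1)) (Site (d + 1))).summable_iff.2 hFs
    have h1 := hGs.hasSum.prod_fiberwise fun u' => (hGs.prod_factor u').hasSum
    have e1 : (∑' p : Site (d + 1) × Site (d + 1), ((fun wu : Site (d + 1) × Site (d + 1) =>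
        colM (coDressKBmAt (toSite r) Lc (KInvStep (d := d) Lc j)) Lc κ' wu.2 ρ wu.1 * M ρ wu.1 w' w g b) ∘
          ⇑(Equiv.prodComm (Site (d + 1)) (Site (d + 1)))) p)
        = ∑' p : Site (d + 1) × Site (d + 1), colM (coDressKBmAt (toSite r) Lc (KInvStep (d := d) Lc j)) Lc κ' p.2 ρ p.1 * M ρ p.1 w' w g b :=
      (Equiv.prodComm (Site (d + 1)) (Site (d + 1))).tsum_eq
        (fun wu : Site (d + 1) × Site (d + 1) => colM (coDressKBmAt (toSite r) Lc (KInvStep (d := d) Lc j)) Lc κ' wu.2 ρ wu.1 * M ρ wu.1 w' w g b)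
    rw [e1, hFs.tsum_prod] at h1
    have e3 : ∀ w'' : Site (d + 1), (∑' u' : Site (d + 1), colM (coDressKBmAt (toSite r) Lc (KInvStep (d := d) Lc j)) Lc κ' u' ρ w'' * M ρ w'' w' w g b) = 0 := by
      intro w''
      rw [tsum_mul_right, (hasSum_slot_colM hr j κ' ρ w'').tsum_eq, zero_mul]
    simp only [Function.comp, Equiv.prodComm_apply, Prod.swap, e3, tsum_zero] at h1
    exact h1
  have h := hasSum_sum fun ρ (_ : ρ ∈ (Finset.univ : Finset (Fin (d + 1)))) => hρ ρ
  rw [Finset.sum_const_zero] at h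
  refine h.congr_fun fun u' => ?_
  simp only [vertexOfM, cwsum_apply]

/-- NOT IN PRINT; OUR BOOKKEEPING.  **THE SLOT ZERO-MODE RULE FOR THE CHAIN-RULE DERIVATIVE** (every `j`, in-block root, any local stencil family `S`, any vertex family `M`, entrywise):
`Σ_{u′} (dM G_j Lc S M κ′ u′) w′ w g b = cH_j·Σ'_t 𝟙[t_{κ′} % Lc = Lc−1]·S κ′ t w′ w g b` — the stencil family on the exit face of its own direction; the multiplier table drops out. -/
theorem hasSum_slot_dM (hr : r ∈ box (d + 1) Lc) (j : ℕ) {S : Fin (d + 1) → Site (d + 1) → MKer (d + 1) (Fib d)} {Cs δs : ℝ}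
    (hS : LocStencil S Cs δs) (hδs : 0 < δs) {M : Fin (d + 1) → Site (d + 1) → MKer (d + 1) (Fib d)} {CM δM : ℝ}
    (hM : VertexFamily M Lc CM δM) (hδM : 0 < δM) (κ' : Fin (d + 1)) (w' w : Site (d + 1)) (g b : Fib d) :
    HasSum (fun u' : Site (d + 1) => dM (coDressKBmAt (toSite r) Lc (KInvStep (d := d) Lc j)) Lc S M κ' u' w' w g b)
      ((stepScale d Lc j * (Lc : ℝ) ^ (d + 1))⁻¹ * ∑' t : Site (d + 1), (if t κ' % (Lc : ℤ) = (Lc : ℤ) - 1 then S κ' t w' w g b else 0)) := by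
  have h := (hasSum_slot_vertexOfK' hr j hS hδs κ' w' w g b).add (hasSum_slot_vertexOfM hr j hM hδM κ' w' w g b)
  rw [add_zero] at h
  refine h.congr_fun fun u' => ?_
  simp only [dM, Pi.add_apply]

end Summit.QuantumFields.BalabanUV.Beta.GAN24.VertexSlotZeroMode

end
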